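import Mathlib

/-!
# Compactness for banded quadratic digit phases — lemmas I: the normal form on bit vectors

Helper file for the stub `stub_compact` of the crux `MobiusLadder.QuadraticDigitPhases`
(stmt-QuantumAdvantage-1391), line `Sketch`.

On an idempotent vector `x` (`xᵢ² = xᵢ`, e.g. a vector of binary digits) a polynomial `Q` of total
degree `≤ 2` evaluates to `c₀ + Σ_{i<j} a_{ij} xᵢ xⱼ + Σᵢ (aᵢ + aᵢᵢ) xᵢ`, where `c₀, aᵢ, aᵢᵢ, a_{ij}` are
the coefficients of `1, Xᵢ, Xᵢ², XᵢXⱼ` in `Q` (`eval_eq_of_totalDegree_le_two`, via the classification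
`finsupp_degree_le_two` of exponent vectors of degree `≤ 2`).  `eval_bits_eq` is the `ℕ`-indexed form of
this identity for the digit vector of `N`, and `coeff_pair_banded` records that an `s`-banded support
forces `j ≤ i + s` for every live pair coefficient `a_{ij}`, `i < j`.  All elementary (folklore).
-/

set_option linter.dupNamespace false -- D-0017: single-problem summit ⇒ QuantumAdvantage.QuantumAdvantage by design

namespace Summit.QuantumAdvantage.QuantumAdvantage.Theorems.MobiusLadderQuadraticDigitPhasesStubCompact

open Finset MvPolynomial

section NormalForm

variable {σ : Type*}

/-- `eᵢ₀ ≠ eᵢ + eⱼ` (the degrees are `1 ≠ 2`). -/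
theorem single_one_ne_single_add (i₀ i j : σ) :
    (Finsupp.single i₀ 1 : σ →₀ ℕ) ≠ Finsupp.single i 1 + Finsupp.single j 1 := by
  intro h
  have := congrArg (fun e : σ →₀ ℕ => e.degree) h
  simp at this

/-- `0 ≠ eᵢ + eⱼ` (the degrees are `0 ≠ 2`). -/
theorem zero_ne_single_add (i j : σ) :
    (0 : σ →₀ ℕ) ≠ Finsupp.single i 1 + Finsupp.single j 1 := by
  intro h
  have := congrArg (fun e : σ →₀ ℕ => e.degree) h
  simp at this

variable [LinearOrder σ]

/-- Exponent vectors of degree `≤ 2`: `d = 0`, `d = eᵢ`, `d = 2eᵢ`, or `d = eᵢ + eⱼ` with `i < j`. -/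
theorem finsupp_degree_le_two (d : σ →₀ ℕ) (hd : d.degree ≤ 2) :
    d = 0 ∨ (∃ i, d = Finsupp.single i 1 ∨ d = Finsupp.single i 2) ∨
      ∃ i j, i < j ∧ d = Finsupp.single i 1 + Finsupp.single j 1 := by
  classical
  have hpos : ∀ i ∈ d.support, 1 ≤ d i := fun i hi =>
    Nat.one_le_iff_ne_zero.mpr (Finsupp.mem_support_iff.mp hi)
  have hdeg : d.degree = ∑ i ∈ d.support, d i := Finsupp.degree_apply d
  have hcard : d.support.card ≤ 2 := by
    have h1 : d.support.card = ∑ i ∈ d.support, 1 := Finset.card_eq_sum_ones _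
    have h2 : ∑ i ∈ d.support, 1 ≤ ∑ i ∈ d.support, d i := Finset.sum_le_sum hpos
    omega
  obtain ⟨m, hm⟩ : ∃ m, d.support.card = m := ⟨_, rfl⟩
  have hm2 : m ≤ 2 := hm ▸ hcard
  interval_cases m
  · exact Or.inl (Finsupp.support_eq_empty.mp (Finset.card_eq_zero.mp hm))
  · obtain ⟨i, hi⟩ := Finset.card_eq_one.mp hm
    have hdi : d.degree = d i := by rw [hdeg, hi, Finset.sum_singleton]
    have hd' : d = Finsupp.single i (d i) := by
      rw [Finsupp.eq_single_iff]
      exact ⟨fun x hx => hi ▸ hx, rfl⟩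
    have h1 : 1 ≤ d i := hpos i (hi ▸ Finset.mem_singleton_self i)
    have h12 : d i = 1 ∨ d i = 2 := by omega
    rcases h12 with h | h
    · rw [h] at hd'
      exact Or.inr (Or.inl ⟨i, Or.inl hd'⟩)
    · rw [h] at hd'
      exact Or.inr (Or.inl ⟨i, Or.inr hd'⟩)
  · obtain ⟨i, j, hij, hs⟩ := Finset.card_eq_two.mp hm
    have hdij : d.degree = d i + d j := by rw [hdeg, hs, Finset.sum_pair hij]
    have hi1 : 1 ≤ d i := hpos i (hs ▸ by simp)
    have hj1 : 1 ≤ d j := hpos j (hs ▸ by simp)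
    have hdi : d i = 1 := by omega
    have hdj : d j = 1 := by omega
    have hd' : d = Finsupp.single i 1 + Finsupp.single j 1 := by
      ext a
      simp only [Finsupp.coe_add, Pi.add_apply, Finsupp.single_apply]
      by_cases hai : i = a
      · subst hai
        simp [Ne.symm hij, hdi]
      · by_cases haj : j = a
        · subst haj
          simp [hai, hdj]
        · have hna : a ∉ d.support := by
            rw [hs]
            simp [Ne.symm hai, Ne.symm haj]
          rw [Finsupp.notMem_support_iff.mp hna]
          simp [hai, haj]
    rcases lt_or_gt_of_ne hij with h | h
    · exact Or.inr (Or.inr ⟨i, j, h, hd'⟩)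
    · exact Or.inr (Or.inr ⟨j, i, h, by rw [hd', add_comm]⟩)

/-- `2eᵢ₀ ≠ eᵢ + eⱼ` when `i < j` (evaluate at `j`). -/
theorem single_two_ne_single_add {i j : σ} (hij : i < j) (i₀ : σ) :
    (Finsupp.single i₀ 2 : σ →₀ ℕ) ≠ Finsupp.single i 1 + Finsupp.single j 1 := by
  intro h
  have := DFunLike.congr_fun h j
  simp only [Finsupp.coe_add, Pi.add_apply, Finsupp.single_apply, hij.ne, if_false,
    if_true, zero_add] at this
  split_ifs at this with h'
  all_goals omega

/-- `eᵢ₀ + eᵢ₁ = eᵢ + eⱼ` with `i₀ < i₁` and `i < j` iff `(i₀, i₁) = (i, j)`. -/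
theorem single_add_eq_single_add_iff {i₀ i₁ i j : σ} (h₀ : i₀ < i₁) (h : i < j) :
    (Finsupp.single i₀ 1 + Finsupp.single i₁ 1 : σ →₀ ℕ) =
        Finsupp.single i 1 + Finsupp.single j 1 ↔ i₀ = i ∧ i₁ = j := by
  rw [Finsupp.single_add_single_eq_single_add_single one_ne_zero one_ne_zero]
  constructor
  · rintro (h1 | ⟨-, rfl, rfl⟩ | ⟨h3, -⟩)
    · exact h1
    · exact (lt_asymm h₀ h).elim
    · omega
  · rintro ⟨rfl, rfl⟩
    exact Or.inl ⟨rfl, rfl⟩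

variable [Fintype σ] {R : Type*} [CommSemiring R]

/-- NORMAL FORM on idempotent vectors.  If `xᵢ² = xᵢ` for all `i` and `Q` has total degree `≤ 2`, then
`Q(x) = c₀ + Σ_{i<j} a_{ij} xᵢ xⱼ + Σᵢ (aᵢ + aᵢᵢ) xᵢ`, where `c₀, aᵢ, aᵢᵢ, a_{ij}` are the coefficients
of `1, Xᵢ, Xᵢ², XᵢXⱼ` in `Q`. -/
theorem eval_eq_of_totalDegree_le_two (Q : MvPolynomial σ R) (hQ : Q.totalDegree ≤ 2) (x : σ → R)
    (hx : ∀ i, x i * x i = x i) :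
    eval x Q = coeff 0 Q +
      ((∑ i, ∑ j, (if i < j then coeff (Finsupp.single i 1 + Finsupp.single j 1) Q else 0) * x i * x j) +
        ∑ i, (coeff (Finsupp.single i 1) Q + coeff (Finsupp.single i 2) Q) * x i) := by
  classical
  set Φ : MvPolynomial σ R → R := fun P => coeff 0 P +
      ((∑ i, ∑ j, (if i < j then coeff (Finsupp.single i 1 + Finsupp.single j 1) P else 0) * x i * x j) +
        ∑ i, (coeff (Finsupp.single i 1) P + coeff (Finsupp.single i 2) P) * x i) with hΦ
  change eval x Q = Φ Q
  -- `Φ` is additive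
  have hadd : ∀ P P' : MvPolynomial σ R, Φ (P + P') = Φ P + Φ P' := by
    intro P P'
    simp only [hΦ, coeff_add]
    have e1 : ∀ i j : σ, (if i < j then coeff (Finsupp.single i 1 + Finsupp.single j 1) P +
        coeff (Finsupp.single i 1 + Finsupp.single j 1) P' else 0) * x i * x j =
        (if i < j then coeff (Finsupp.single i 1 + Finsupp.single j 1) P else 0) * x i * x j +
        (if i < j then coeff (Finsupp.single i 1 + Finsupp.single j 1) P' else 0) * x i * x j := by
      intro i j
      split_ifs <;> ring
    simp only [e1, add_mul, Finset.sum_add_distrib]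
    ring
  have hzero : Φ 0 = 0 := by simp [hΦ]
  -- the identity for monomials of degree `≤ 2`
  have hmono : ∀ d : σ →₀ ℕ, d.degree ≤ 2 → ∀ c : R, eval x (monomial d c) = Φ (monomial d c) := by
    intro d hd c
    rcases finsupp_degree_le_two d hd with rfl | ⟨i₀, rfl | rfl⟩ | ⟨i₀, i₁, hlt, rfl⟩
    · -- the constant monomial
      have z1 : ∀ i : σ, ((0 : σ →₀ ℕ) = Finsupp.single i 1) ↔ False := fun i => by
        rw [eq_comm]; simp
      have z2 : ∀ i : σ, ((0 : σ →₀ ℕ) = Finsupp.single i 2) ↔ False := fun i => by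
        rw [eq_comm]; simp
      simp [hΦ, z1, z2, zero_ne_single_add]
    · -- `Xᵢ₀`
      have s11 : ∀ i : σ, (Finsupp.single i₀ 1 : σ →₀ ℕ) = Finsupp.single i 1 ↔ i₀ = i := fun i =>
        Finsupp.single_left_inj one_ne_zero
      have s12 : ∀ i : σ, ((Finsupp.single i₀ 1 : σ →₀ ℕ) = Finsupp.single i 2) ↔ False := fun i => by
        simp [Finsupp.single_eq_single_iff]
      simp [hΦ, coeff_monomial, s11, s12, single_one_ne_single_add, eval_monomial]
    · -- `Xᵢ₀²`
      have s21 : ∀ i : σ, ((Finsupp.single i₀ 2 : σ →₀ ℕ) = Finsupp.single i 1) ↔ False := fun i => by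
        simp [Finsupp.single_eq_single_iff]
      have s22 : ∀ i : σ, (Finsupp.single i₀ 2 : σ →₀ ℕ) = Finsupp.single i 2 ↔ i₀ = i := fun i =>
        Finsupp.single_left_inj two_ne_zero
      have hC : ∀ i j : σ, (if i < j then (if (Finsupp.single i₀ 2 : σ →₀ ℕ) =
          Finsupp.single i 1 + Finsupp.single j 1 then c else 0) else 0) = 0 := by
        intro i j
        split_ifs with h1 h2
        · exact absurd h2 (single_two_ne_single_add h1 i₀)
        · rfl
        · rfl
      have hev : eval x (monomial (Finsupp.single i₀ 2) c) = c * x i₀ := by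
        simp [eval_monomial, sq, hx]
      rw [hev]
      simp only [hΦ, coeff_monomial, hC, zero_mul, Finset.sum_const_zero, zero_add]
      simp [s21, s22]
    · -- `Xᵢ₀ Xᵢ₁`, `i₀ < i₁`
      have hev : eval x (monomial (Finsupp.single i₀ 1 + Finsupp.single i₁ 1) c) = c * x i₀ * x i₁ := by
        rw [monomial_single_add, ← C_mul_X_pow_eq_monomial]
        simp only [map_mul, eval_X, eval_C, pow_one]
        ring
      have a0 : ((Finsupp.single i₀ 1 + Finsupp.single i₁ 1 : σ →₀ ℕ) = 0) ↔ False :=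
        iff_false_intro (zero_ne_single_add i₀ i₁).symm
      have a1 : ∀ i : σ, ((Finsupp.single i₀ 1 + Finsupp.single i₁ 1 : σ →₀ ℕ) =
          Finsupp.single i 1) ↔ False := fun i =>
        iff_false_intro (single_one_ne_single_add i i₀ i₁).symm
      have a2 : ∀ i : σ, ((Finsupp.single i₀ 1 + Finsupp.single i₁ 1 : σ →₀ ℕ) =
          Finsupp.single i 2) ↔ False := fun i =>
        iff_false_intro (single_two_ne_single_add hlt i).symm
      have hD : ∀ i j : σ, (if i < j then (if (Finsupp.single i₀ 1 + Finsupp.single i₁ 1 : σ →₀ ℕ) =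
          Finsupp.single i 1 + Finsupp.single j 1 then c else 0) else 0) =
          if i₀ = i then (if i₁ = j then c else 0) else 0 := by
        intro i j
        by_cases h1 : i < j
        · simp only [if_pos h1, single_add_eq_single_add_iff hlt h1]
          by_cases h3 : i₀ = i <;> by_cases h4 : i₁ = j <;> simp [h3, h4]
        · rw [if_neg h1]
          by_cases h3 : i₀ = i
          · subst h3
            by_cases h4 : i₁ = j
            · subst h4
              exact absurd hlt h1
            · simp [h4]
          · simp [h3]
      have hquad : ∑ i, ∑ j, (if i₀ = i then (if i₁ = j then c else 0) else 0) * x i * x j =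
          c * x i₀ * x i₁ := by
        rw [Finset.sum_eq_single_of_mem i₀ (mem_univ _) (fun i _ hi => by simp [Ne.symm hi])]
        rw [Finset.sum_eq_single_of_mem i₁ (mem_univ _) (fun j _ hj => by simp [Ne.symm hj])]
        simp
      rw [hev]
      simp only [hΦ, coeff_monomial, hD]
      rw [hquad]
      simp [a0, a1, a2]
  -- assemble along `Q = Σ_{d ∈ support} monomial d (coeff d Q)`
  have key : ∀ P : MvPolynomial σ R, P ∈ (Q.support.image fun d => monomial d (coeff d Q)) →
      eval x P = Φ P := by
    intro P hP
    obtain ⟨d, hd, rfl⟩ := Finset.mem_image.mp hP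
    exact hmono d ((le_totalDegree hd).trans hQ) _
  have hsum : eval x (∑ d ∈ Q.support, monomial d (coeff d Q)) =
      Φ (∑ d ∈ Q.support, monomial d (coeff d Q)) := by
    refine Finset.sum_induction (fun d => monomial d (coeff d Q)) (fun P => eval x P = Φ P)
      (fun P P' hP hP' => ?_) (by simp [hzero]) (fun d hd => ?_)
    · rw [map_add, hadd, hP, hP']
    · exact hmono d ((le_totalDegree hd).trans hQ) _
  rwa [← Q.as_sum] at hsum

/-- The normal form for the digit vector of `N` on `n` places, with `ℕ`-indexed coefficient functions:
`Q(bits N) = c₀ + Σ_{i,j<n} qd i j · xᵢ xⱼ + Σ_{i<n} ld i · xᵢ`, `xᵢ = 𝟙[bit i of N]`, whenever `qd`, `ld`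
agree on `[0,n)` with the pair (`i < j`) and the singleton coefficients of `Q`. -/
theorem eval_bits_eq {n : ℕ} (Q : MvPolynomial (Fin n) (ZMod 2)) (hQ : Q.totalDegree ≤ 2)
    (qd : ℕ → ℕ → ZMod 2) (ld : ℕ → ZMod 2)
    (hqd : ∀ i j : Fin n, qd i j =
      if i < j then coeff (Finsupp.single i 1 + Finsupp.single j 1) Q else 0)
    (hld : ∀ i : Fin n, ld i = coeff (Finsupp.single i 1) Q + coeff (Finsupp.single i 2) Q) (N : ℕ) :
    eval (fun i : Fin n => if Nat.testBit N i then (1 : ZMod 2) else 0) Q =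
      coeff 0 Q +
        ((∑ i ∈ range n, ∑ j ∈ range n, qd i j * (if Nat.testBit N i then (1 : ZMod 2) else 0) *
            (if Nat.testBit N j then (1 : ZMod 2) else 0)) +
          ∑ i ∈ range n, ld i * (if Nat.testBit N i then (1 : ZMod 2) else 0)) := by
  rw [eval_eq_of_totalDegree_le_two Q hQ _ (fun i => by split_ifs <;> simp)]
  simp only [← Fin.sum_univ_eq_sum_range, hqd, hld]

/-- Bandedness: if every monomial of `Q` has its variables pairwise within distance `s`, then a nonzero
pair coefficient `a_{ij}`, `i < j`, has `j ≤ i + s`. -/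
theorem coeff_pair_banded {n s : ℕ} {Q : MvPolynomial (Fin n) (ZMod 2)}
    (hband : ∀ m ∈ Q.support, ∀ i ∈ m.support, ∀ j ∈ m.support, Nat.dist i j ≤ s)
    {i j : Fin n} (hij : i < j) (hc : coeff (Finsupp.single i 1 + Finsupp.single j 1) Q ≠ 0) :
    (j : ℕ) ≤ i + s := by
  have hne : i ≠ j := hij.ne
  have hm := hband _ (mem_support_iff.mpr hc) i ?_ j ?_
  · rw [Nat.dist_eq_sub_of_le (le_of_lt hij)] at hm
    have : (i : ℕ) < j := hij
    omega
  · rw [Finsupp.mem_support_iff]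
    simp [hne.symm]
  · rw [Finsupp.mem_support_iff]
    simp [hne]

end NormalForm

end Summit.QuantumAdvantage.QuantumAdvantage.Theorems.MobiusLadderQuadraticDigitPhasesStubCompact
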